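import Summits.QuantumFields.YangMills.Theorems.SwapVirialDeficitBlowUpLeaderChart
import Summits.QuantumFields.YangMills.Theorems.SwapVirialDeficitBlowUpLeaderDominator
import Summits.QuantumFields.YangMills.Theorems.SwapVirialDeficitBlowUpFollowerBox
import HarnessLib

/-!
# The joint DOMINATOR of the blow-up (brick J4, assembly, of memo-24197-massive-mode-rung): hypothesis (D″) of the shell from the box data
# (free-hands support of ⟨stmt-QuantumFields-24197⟩ `SwapVirialDeficit.SwapGluedStiffness`; consumes ✓`…BlowUpLeaderDominator`, ✓`…BlowUpFollowerBox`,
# ✓`…BlowUpLeaderChart`; feeds ✓`BlowUp.smallBall_limit_real_of_blowUp_of_weight_ae`)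

GENERIC IN THE FOLLOWER INDEX `ι` (w2 g57's `BlowUpRing.Fol L` is the intended instance), on the blow-up space
`B = ℍ × (((ℍ × ℍ) × ℍ) × (ι → ℍ))` with `β = cone ⊗ (vol³ ⊗ vol^ι)`:

* `dominatorWeight R K (a, (w, y)) := sigmaDom A(a) (dil3 R⁻¹ w) · 𝟙{∀ i, |re yᵢ| < 1 ∧ ‖Im yᵢ‖ ≤ K}` — w3 g63's leader dominator at threshold `R` times the follower box;
* ★★ `lintegral_dominatorWeight_ne_top` — `∫ dominatorWeight R K dβ = R⁷·(∫ sigmaDom d(cone ⊗ vol³))·vol(box_K)^{|ι|} < ∞` (`lintegral_prod_mul`);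
* ★ `leaderTuple_mem_sigmaBall_iff` — the bridge `leaderTuple a w' ∈ sigmaBall s ↔ w' ∈ transSet s A(a)` (letters non-zero);
* ★★★ `ae_one_le_dominatorWeight` — for `β`-a.e. `x = (a, (w, y))` and EVERY `t > 0`: if the leaders `leaderTuple a (dil3 t w)` lie in `sigmaBall (R·t)` with
  `dil3 t w ∈ ball3`, and every follower letter `quatToSU2 (dilateIm t (y i))` is in the unit-ball chart and within `K·t` of `1` in Frobenius norm, then
  `1 ≤ dominatorWeight R K x`.  With ✓`SwapRing.swapCommBox_of_swapRingDeficit` (w2 g57's chart form `chartBox_of_chartDeficit`) at `F ≤ r·u = r·t²` these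
  hypotheses hold with `R = 60L³√r/√2` (✓`swapCommSet_subset_quat`) and `K = 48L³√r`, uniformly in `u` — i.e. (D″) for the event `E r u` of the scaling identity (S).

HONEST LABEL: measure theory on the blow-up space (plan-level plumbing); NOT the fixed-`L` sharp law, NOT ⟨24197⟩; the Yang–Mills mass gap is NOT proved; no summit is
proved by a line.  Seat ym-line-fcl-p3 g45 (cell ym-idea-1, free hands; item of record ⟨24085⟩ aside, untouched), `--supports stmt-QuantumFields-24197`.  One `def`
(`dominatorWeight`), theorems otherwise; 0 `sorry`; standard axioms; the series' local `ℍ` instances.  References: [folklore].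
-/

set_option autoImplicit false

noncomputable section

open MeasureTheory Quaternion Set
open scoped Quaternion ENNReal BigOperators
open Literature.MathematicalPhysics.QuantumLattice
open Literature.MathematicalPhysics.QuantumFieldTheory (haarProbability frobNorm frobNorm_nonneg)
open Literature.MathematicalPhysics.QuantumFieldTheory.Balaban1983to89.T4HaarSU2Translate (su2Quat_quatToSU2)
open Literature.Analysis.Calculus (radialUnit radialUnit_def norm_radialUnit)
open Summit.QuantumFields.YangMills.Theorems.SwapTwistDeficit.ToronLog
open Summit.QuantumFields.YangMills.Theorems.SwapVirialDeficit.ZeroModeGroup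

attribute [local instance] Literature.Analysis.FluidPDE.Tao2016.quatMeasurableSpace
  Literature.Analysis.FluidPDE.Tao2016.quatBorelSpace
  Literature.MathematicalPhysics.QuantumLattice.secondCountableTopology_su2

namespace Summit.QuantumFields.YangMills.Theorems.SwapVirialDeficit.BlowUp

open Summit.QuantumFields.YangMills.Theorems.SwapVirialDeficit.ZeroModeSigma

variable {ι : Type*} [Fintype ι]

/-! ## §1 The weight and its integral -/

/-- **The joint dominator weight** at leader threshold `R` and follower box size `K`: w3 g63's `t`-free leader dominator pulled back along `dil3 R⁻¹`, times the
indicator of the follower box. [folklore] -/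
def dominatorWeight (R K : ℝ) (x : ℍ × (((ℍ × ℍ) × ℍ) × (ι → ℍ))) : ℝ≥0∞ :=
  sigmaDom (radialUnit (axisPoint x.1)) (dil3 R⁻¹ x.2.1) *
    (Set.univ.pi fun _ : ι => {y : ℍ | |y.re| < 1 ∧ ‖y.im‖ ≤ K}).indicator (1 : (ι → ℍ) → ℝ≥0∞) x.2.2

/-- The follower box is measurable. [folklore] -/
theorem measurableSet_followerBox (K : ℝ) : MeasurableSet {y : ℍ | |y.re| < 1 ∧ ‖y.im‖ ≤ K} := by
  have h1 : MeasurableSet {y : ℍ | |y.re| < 1} := measurableSet_lt (Quaternion.continuous_re.measurable.abs) measurable_const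
  have h2 : MeasurableSet {y : ℍ | ‖y.im‖ ≤ K} := measurableSet_le (Quaternion.continuous_im.measurable.norm) measurable_const
  exact h1.inter h2

/-- `dominatorWeight R K` is measurable. [folklore] -/
theorem measurable_dominatorWeight (R K : ℝ) : Measurable (dominatorWeight (ι := ι) R K) := by
  have hT : Measurable fun x : ℍ × (((ℍ × ℍ) × ℍ) × (ι → ℍ)) => (x.1, dil3 R⁻¹ x.2.1) :=
    measurable_fst.prodMk ((measurable_dil3 R⁻¹).comp (measurable_fst.comp measurable_snd))
  have h1' := measurable_sigmaDom_hub.comp hT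
  have h1 : Measurable fun x : ℍ × (((ℍ × ℍ) × ℍ) × (ι → ℍ)) => sigmaDom (radialUnit (axisPoint x.1)) (dil3 R⁻¹ x.2.1) := h1'
  have h2 : Measurable fun x : ℍ × (((ℍ × ℍ) × ℍ) × (ι → ℍ)) =>
      (Set.univ.pi fun _ : ι => {y : ℍ | |y.re| < 1 ∧ ‖y.im‖ ≤ K}).indicator (1 : (ι → ℍ) → ℝ≥0∞) x.2.2 :=
    (measurable_one.indicator (MeasurableSet.univ_pi fun _ => measurableSet_followerBox K)).comp (measurable_snd.comp measurable_snd)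
  exact h1.mul h2

/-- ★★ **The weight has finite integral**: `∫ dominatorWeight R K d(cone ⊗ (vol³ ⊗ vol^ι)) = (R⁷·∫sigmaDom)·vol(box)^{|ι|} ≠ ∞` (`R > 0`). [folklore] -/
theorem lintegral_dominatorWeight_ne_top {R : ℝ} (hR : 0 < R) (K : ℝ) :
    ∫⁻ x, dominatorWeight R K x ∂(coneMeasure.prod (vol3.prod (Measure.pi fun _ : ι => (volume : Measure ℍ)))) ≠ ∞ := by
  haveI := isProbabilityMeasure_coneMeasure
  haveI := sFinite_vol3
  -- regroup `cone ⊗ (vol³ ⊗ vol^ι)` as `(cone ⊗ vol³) ⊗ vol^ι`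
  have hm := measurable_dominatorWeight (ι := ι) R K
  have hassoc := measurePreserving_prodAssoc coneMeasure vol3 (Measure.pi fun _ : ι => (volume : Measure ℍ))
  rw [← hassoc.lintegral_comp hm]
  have e' : (fun z : (ℍ × ((ℍ × ℍ) × ℍ)) × (ι → ℍ) => dominatorWeight R K (MeasurableEquiv.prodAssoc z)) =
      fun z => (fun q : ℍ × ((ℍ × ℍ) × ℍ) => sigmaDom (radialUnit (axisPoint q.1)) (dil3 R⁻¹ q.2)) z.1 *
        (fun y : ι → ℍ => (Set.univ.pi fun _ : ι => {y : ℍ | |y.re| < 1 ∧ ‖y.im‖ ≤ K}).indicator (1 : (ι → ℍ) → ℝ≥0∞) y) z.2 := by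
    funext z
    rcases z with ⟨⟨a, w⟩, y⟩
    rfl
  show ∫⁻ z, dominatorWeight R K (MeasurableEquiv.prodAssoc z) ∂((coneMeasure.prod vol3).prod
    (Measure.pi fun _ : ι => (volume : Measure ℍ))) ≠ ⊤
  rw [e', vol3_def]
  have hT : Measurable fun q : ℍ × ((ℍ × ℍ) × ℍ) => (q.1, dil3 R⁻¹ q.2) := measurable_fst.prodMk ((measurable_dil3 R⁻¹).comp measurable_snd)
  have hf' := measurable_sigmaDom_hub.comp hT
  have hf : Measurable fun q : ℍ × ((ℍ × ℍ) × ℍ) => sigmaDom (radialUnit (axisPoint q.1)) (dil3 R⁻¹ q.2) := hf'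
  have hg : Measurable fun y : ι → ℍ => (Set.univ.pi fun _ : ι => {y : ℍ | |y.re| < 1 ∧ ‖y.im‖ ≤ K}).indicator (1 : (ι → ℍ) → ℝ≥0∞) y :=
    measurable_one.indicator (MeasurableSet.univ_pi fun _ => measurableSet_followerBox K)
  rw [lintegral_prod_mul hf.aemeasurable hg.aemeasurable, lintegral_indicator_one (MeasurableSet.univ_pi fun _ => measurableSet_followerBox K)]
  exact ENNReal.mul_ne_top (lintegral_sigmaDom_dil3_inv hR).2 (pi_volume_followerBox_ne_top K)

/-! ## §2 The bridge: the axial leader tuple lies in `sigmaBall` iff its cone coordinates lie in `transSet` -/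

/-- ★ **The bridge**: for a hub `a ≠ 0` and non-zero cone letters, `leaderTuple a w' ∈ sigmaBall s ↔ w' ∈ transSet s (radialUnit (axisPoint a))` (`s ≥ 0`):
`su2Quat` of the tuple is `(x̂, p·ẑ, ŷ, A)` (✓`sigmaBall_eq_preimage_sigmaSet`, ✓`mem_transSet_iff`). [folklore] -/
theorem leaderTuple_mem_sigmaBall_iff {s : ℝ} (hs : 0 ≤ s) {a : ℍ} (ha : a ≠ 0) {w' : (ℍ × ℍ) × ℍ} (hx : w'.1.1 ≠ 0) (hy : w'.1.2 ≠ 0) (hz : w'.2 ≠ 0) :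
    leaderTuple a w' ∈ sigmaBall s ↔ w' ∈ transSet s (radialUnit (axisPoint a)) := by
  have hA : ‖radialUnit (axisPoint a)‖ = 1 := norm_axisUnit ha
  have hp : ‖slaveP (radialUnit (axisPoint a)) w'.1.1‖ = 1 := norm_slaveP hA hx
  have hpz : slaveP (radialUnit (axisPoint a)) w'.1.1 * w'.2 ≠ 0 := by
    intro h
    rcases mul_eq_zero.1 h with h1 | h1
    · rw [h1, norm_zero] at hp; exact zero_ne_one hp
    · exact hz h1
  have hA0 : radialUnit (axisPoint a) ≠ 0 := by
    intro h; rw [h, norm_zero] at hA; exact zero_ne_one hA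
  have hAfix : su2Quat (quatToSU2 (radialUnit (axisPoint a))) = radialUnit (axisPoint a) := by
    rw [su2Quat_quatToSU2 hA0, hA, inv_one, one_smul]
  obtain ⟨h0, h1, h2, h3⟩ := leaderTuple_apply a w'
  rw [sigmaBall_eq_preimage_sigmaSet hs, Set.mem_setOf_eq, mem_transSet_iff, h0, h1, h2, h3, su2Quat_quatToSU2_eq_radialUnit hx,
    su2Quat_quatToSU2_eq_radialUnit hpz, su2Quat_quatToSU2_eq_radialUnit hy, hAfix, radialUnit_mul_left hp]

/-! ## §3 The a.e. domination -/

/-- ★★★ **(D″) FROM THE BOX DATA**: for `β`-a.e. blow-up point `x = (a, (w, y))` and EVERY scale `t > 0`: if the leaders at scale `t` lie in `sigmaBall (R·t)` with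
cone coordinates in the unit balls, and every follower letter `quatToSU2 (dilateIm t (y i))` lies in the unit-ball chart within Frobenius distance `K·t` of `1`, then
`1 ≤ dominatorWeight R K x` (`R > 0`, `K ≥ 0`). [folklore] -/
theorem ae_one_le_dominatorWeight {R K : ℝ} (hR : 0 < R) (hK : 0 ≤ K) :
    ∀ᵐ x : ℍ × (((ℍ × ℍ) × ℍ) × (ι → ℍ)) ∂(coneMeasure.prod (vol3.prod (Measure.pi fun _ : ι => (volume : Measure ℍ)))),
      ∀ t : ℝ, 0 < t →
        leaderTuple x.1 (dil3 t x.2.1) ∈ sigmaBall (R * t) → dil3 t x.2.1 ∈ ball3 →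
        (∀ i, ‖dilateIm t (x.2.2 i)‖ < 1 ∧ dilateIm t (x.2.2 i) ≠ 0 ∧
          frobNorm (((quatToSU2 (dilateIm t (x.2.2 i)) : Matrix.specialUnitaryGroup (Fin 2) ℂ) : Matrix (Fin 2) (Fin 2) ℂ) - 1) ≤ K * t) →
        1 ≤ dominatorWeight R K x := by
  haveI := isProbabilityMeasure_coneMeasure
  haveI := sFinite_vol3
  -- the null sets: hub `a = 0`, cone letters `x = 0`, `y = 0`, `z = 0` — transported from `cone ⊗ vol³`
  have hq : ∀ᵐ q : ℍ × ((ℍ × ℍ) × ℍ) ∂(coneMeasure.prod vol3), q.1 ≠ 0 ∧ q.2.1.1 ≠ 0 ∧ q.2.1.2 ≠ 0 ∧ q.2.2 ≠ 0 := by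
    have h1 : ∀ᵐ q : ℍ × ((ℍ × ℍ) × ℍ) ∂(coneMeasure.prod vol3), q.1 ≠ 0 :=
      (Measure.quasiMeasurePreserving_fst (μ := coneMeasure) (ν := vol3)).ae ae_ne_zero_coneMeasure
    have hw : ∀ᵐ w : (ℍ × ℍ) × ℍ ∂vol3, w.1.1 ≠ 0 ∧ w.1.2 ≠ 0 ∧ w.2 ≠ 0 := by
      have h0 : (volume : Measure ℍ) {0} = 0 := measure_singleton 0
      have n1 : vol3 {w : (ℍ × ℍ) × ℍ | w.1.1 = 0} = 0 := by
        have e : {w : (ℍ × ℍ) × ℍ | w.1.1 = 0} = (({0} : Set ℍ) ×ˢ (Set.univ : Set ℍ)) ×ˢ (Set.univ : Set ℍ) := by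
          ext w; simp
        rw [e, vol3_def, Measure.prod_prod, Measure.prod_prod, h0, zero_mul, zero_mul]
      have n2 : vol3 {w : (ℍ × ℍ) × ℍ | w.1.2 = 0} = 0 := by
        have e : {w : (ℍ × ℍ) × ℍ | w.1.2 = 0} = ((Set.univ : Set ℍ) ×ˢ ({0} : Set ℍ)) ×ˢ (Set.univ : Set ℍ) := by
          ext w; simp
        rw [e, vol3_def, Measure.prod_prod, Measure.prod_prod, h0, mul_zero, zero_mul]
      have n3 : vol3 {w : (ℍ × ℍ) × ℍ | w.2 = 0} = 0 := by
        have e : {w : (ℍ × ℍ) × ℍ | w.2 = 0} = (Set.univ : Set (ℍ × ℍ)) ×ˢ ({0} : Set ℍ) := by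
          ext w; simp
        rw [e, vol3_def, Measure.prod_prod, h0, mul_zero]
      have a1 : ∀ᵐ w : (ℍ × ℍ) × ℍ ∂vol3, w.1.1 ≠ 0 := by rw [ae_iff]; simpa only [ne_eq, not_not] using n1
      have a2 : ∀ᵐ w : (ℍ × ℍ) × ℍ ∂vol3, w.1.2 ≠ 0 := by rw [ae_iff]; simpa only [ne_eq, not_not] using n2
      have a3 : ∀ᵐ w : (ℍ × ℍ) × ℍ ∂vol3, w.2 ≠ 0 := by rw [ae_iff]; simpa only [ne_eq, not_not] using n3
      filter_upwards [a1, a2, a3] with w h1 h2 h3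
      exact ⟨h1, h2, h3⟩
    have h2 := (Measure.quasiMeasurePreserving_snd (μ := coneMeasure) (ν := vol3)).ae hw
    filter_upwards [h1, h2] with q ha hw' using ⟨ha, hw'⟩
  have hx : ∀ᵐ x : ℍ × (((ℍ × ℍ) × ℍ) × (ι → ℍ)) ∂(coneMeasure.prod (vol3.prod (Measure.pi fun _ : ι => (volume : Measure ℍ)))),
      x.1 ≠ 0 ∧ x.2.1.1.1 ≠ 0 ∧ x.2.1.1.2 ≠ 0 ∧ x.2.1.2 ≠ 0 := by
    have hassoc := (measurePreserving_prodAssoc coneMeasure vol3 (Measure.pi fun _ : ι => (volume : Measure ℍ))).symm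
    have h' : ∀ᵐ z : (ℍ × ((ℍ × ℍ) × ℍ)) × (ι → ℍ) ∂((coneMeasure.prod vol3).prod (Measure.pi fun _ : ι => (volume : Measure ℍ))),
        z.1.1 ≠ 0 ∧ z.1.2.1.1 ≠ 0 ∧ z.1.2.1.2 ≠ 0 ∧ z.1.2.2 ≠ 0 :=
      (Measure.quasiMeasurePreserving_fst (μ := coneMeasure.prod vol3) (ν := Measure.pi fun _ : ι => (volume : Measure ℍ))).ae hq
    have key := hassoc.quasiMeasurePreserving.ae h'
    filter_upwards [key] with x hx
    rcases x with ⟨a, ⟨w, y⟩⟩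
    exact hx
  filter_upwards [hx] with x hne t ht hlead hball hfoll
  obtain ⟨ha, hx1, hy1, hz1⟩ := hne
  -- leaders: into `rescaledSigmaR R t A(a)`, then w3's dominator
  have hx1' : (dil3 t x.2.1).1.1 ≠ 0 := by rw [dil3_apply]; exact dilate_ne_zero ht.ne' hx1
  have hy1' : (dil3 t x.2.1).1.2 ≠ 0 := by rw [dil3_apply]; exact dilate_ne_zero ht.ne' hy1
  have hz1' : (dil3 t x.2.1).2 ≠ 0 := by
    rw [dil3_apply]
    intro h
    have h0 : dilateIm t x.2.1.2 = 0 := h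
    apply hz1
    have h' : dilateIm t⁻¹ (dilateIm t x.2.1.2) = x.2.1.2 := by
      rw [dilateIm_dilateIm, inv_mul_cancel₀ ht.ne', dilateIm_one_apply]
    rw [← h', h0, map_zero]
  have hmem : x.2.1 ∈ rescaledSigmaR R t (radialUnit (axisPoint x.1)) := by
    rw [rescaledSigmaR_def, Set.mem_preimage, Set.mem_inter_iff]
    exact ⟨(leaderTuple_mem_sigmaBall_iff (by positivity) ha hx1' hy1' hz1').1 hlead, hball⟩
  have hlead1 : 1 ≤ sigmaDom (radialUnit (axisPoint x.1)) (dil3 R⁻¹ x.2.1) := by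
    have h := indicator_rescaledSigmaR_le_sigmaDom_dil3 hR ht ha x.2.1 hx1
    rw [Set.indicator_of_mem hmem, Pi.one_apply] at h
    exact h
  -- followers: into the box
  have hbox : x.2.2 ∈ Set.univ.pi (fun _ : ι => {y : ℍ | |y.re| < 1 ∧ ‖y.im‖ ≤ K}) := by
    refine Set.mem_univ_pi.2 fun i => ?_
    obtain ⟨hb, hne, hfd⟩ := hfoll i
    exact follower_box ht hK hb hne hfd
  unfold dominatorWeight
  rw [Set.indicator_of_mem hbox, Pi.one_apply, mul_one]
  exact hlead1

end Summit.QuantumFields.YangMills.Theorems.SwapVirialDeficit.BlowUp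

end
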